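import Summits.CriticalPhenomena.CardyFormulaZ2.Theorems.CardyComplexConeParafermionToSLESixFamiliesDiamondTraceFrame
import HarnessLib

/-!
# Boundary positions on a marked diamond and the mark count along consecutive boundary segments
# (line `potential-darboux-picard-diamond`, S1′ TURN, part 2)

Crux `ParafermionToSLESixFamilies` (stmt-CriticalPhenomena-11389), line `potential-darboux-picard-diamond`,
stub `stub_exactPotentialTracePh` (S1′), clause (TURN). Sequel of `…DiamondTraceFrame.lean` (frame `dRot`,
sides `dParam k s`, `segData_of_isBdrySegment`). Here: the counter-clockwise BOUNDARY POSITION `dPos` (blocks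
of width `dBlock = 2α + 2β + 1` per side, cut at the corner `(-α,-β)`), its value on parametrised points
(`dPos_dParam`), the parametrisation of frontier points (`exists_dParam_of_bdry`, `dParam_inj`), and the
MARK-STEP lemmas: for an oriented boundary segment `[P, V]` and a boundary point `M ∉ (P, V)`,
`[dPos M ≤ dPos V] = [dPos M ≤ dPos P] + [M = V]` (`markStep`), except across the cut, where
`dPos M ≤ dPos P` always and `dPos M ≤ dPos V ↔ M = V` (`markStep_cut`). These are the two bookkeeping
identities behind the `π/3·[v is a mark]` term of the Schwarz–Christoffel turning rule. Elementary; nothing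
cited.
-/

noncomputable section

namespace Summit.CriticalPhenomena.CardyFormulaZ2.Cruxes.ParafermionToSLESixFamilies.PotentialDarbouxPicardDiamond

open Set Metric Complex
open Literature.Probability.RandomPlanarGeometry

variable {α β : ℝ}

/-! ## Coordinates of the parametrisation -/

/-- The real and imaginary parts of `dParam`, side by side. -/
theorem dParam_re_im (α β : ℝ) (k : Fin 4) (s : ℝ) :
    (k = 0 ∧ (dParam α β k s).re = -α + s ∧ (dParam α β k s).im = -β) ∨
    (k = 1 ∧ (dParam α β k s).re = α ∧ (dParam α β k s).im = -β + s) ∨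
    (k = 2 ∧ (dParam α β k s).re = α - s ∧ (dParam α β k s).im = β) ∨
    (k = 3 ∧ (dParam α β k s).re = -α ∧ (dParam α β k s).im = β - s) := by
  fin_cases k <;> simp [dParam, dCorner, dDir] <;> ring

/-- Differences along one side: `dParam k t - dParam k s = (t - s) dDir k`. -/
theorem dParam_sub (α β : ℝ) (k : Fin 4) (s t : ℝ) :
    dParam α β k t - dParam α β k s = ((t - s : ℝ) : ℂ) * dDir k := by
  unfold dParam; push_cast; ring

/-- `dParam k 0` is the corner `k`. -/
theorem dParam_zero (α β : ℝ) (k : Fin 4) : dParam α β k 0 = dCorner α β k := by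
  simp [dParam]

/-- The end of side `k` is the corner `k + 1`. -/
theorem dParam_dLen (α β : ℝ) (k : Fin 4) : dParam α β k (dLen α β k) = dCorner α β (k + 1) := by
  fin_cases k <;> simp [dParam, dCorner, dDir, dLen] <;> ring

/-- Points strictly between two parameters of a side lie on the open segment between the two points. -/
theorem dParam_mem_openSegment (k : Fin 4) {s m t : ℝ} (hsm : s < m) (hmt : m < t) :
    dParam α β k m ∈ openSegment ℝ (dParam α β k s) (dParam α β k t) := by
  rw [openSegment_eq_image']
  refine ⟨(m - s) / (t - s), ⟨div_pos (by linarith) (by linarith), (div_lt_one (by linarith)).2 (by linarith)⟩, ?_⟩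
  have hmul : ((m - s) / (t - s) : ℝ) * (t - s) = m - s :=
    div_mul_cancel₀ _ (by intro h; linarith)
  simp only [dParam_sub, real_smul]
  rw [← mul_assoc, ← Complex.ofReal_mul, hmul, ← dParam_sub]
  ring

/-- Every side has positive length. -/
theorem dLen_pos (hα : 0 < α) (hβ : 0 < β) (k : Fin 4) : 0 < dLen α β k := by
  fin_cases k <;> simp [dLen] <;> linarith

/-- **Boundary points are parametrised**: a point of the closed rectangle that is not in the open
rectangle is `dParam k s` for some side `k` and `0 ≤ s < dLen k`. -/
theorem exists_dParam_of_bdry (hα : 0 < α) {w : ℂ} (hre : |w.re| ≤ α) (him : |w.im| ≤ β)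
    (hnot : ¬ (|w.re| < α ∧ |w.im| < β)) :
    ∃ (k : Fin 4) (s : ℝ), 0 ≤ s ∧ s < dLen α β k ∧ w = dParam α β k s := by
  rw [abs_le] at hre him
  rw [abs_lt, abs_lt] at hnot
  by_cases h0 : w.im = -β ∧ w.re < α
  · refine ⟨0, w.re + α, by linarith, by simp only [dLen, Matrix.cons_val]; linarith, Complex.ext ?_ ?_⟩
    · simp [dParam, dCorner, dDir]
    · simp [dParam, dCorner, dDir, h0.1]
  by_cases h1 : w.re = α ∧ w.im < β
  · refine ⟨1, w.im + β, by linarith, by simp only [dLen, Matrix.cons_val]; linarith, Complex.ext ?_ ?_⟩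
    · simp [dParam, dCorner, dDir, h1.1]
    · simp [dParam, dCorner, dDir]
  by_cases h2 : w.im = β ∧ -α < w.re
  · refine ⟨2, α - w.re, by linarith, by simp only [dLen, Matrix.cons_val]; linarith, Complex.ext ?_ ?_⟩
    · simp [dParam, dCorner, dDir]
    · simp [dParam, dCorner, dDir, h2.1]
  · have hre' : w.re = -α := by
      rcases hre.1.eq_or_lt with ha | ha
      · exact ha.symm
      · rcases hre.2.eq_or_lt' with hb | hb
        · exfalso
          rcases him.2.eq_or_lt' with hc | hc
          · exact h2 ⟨hc.symm, ha⟩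
          · exact h1 ⟨hb.symm, hc⟩
        · exfalso
          rcases him.1.eq_or_lt with hc | hc
          · exact h0 ⟨hc.symm, hb⟩
          · rcases him.2.eq_or_lt' with hd | hd
            · exact h2 ⟨hd.symm, ha⟩
            · exact hnot ⟨⟨ha, hb⟩, hc, hd⟩
    have him' : -β < w.im := by
      rcases him.1.eq_or_lt with ha | ha
      · exact absurd ⟨ha.symm, by rw [hre']; linarith⟩ h0
      · exact ha
    refine ⟨3, β - w.im, by linarith, by simp only [dLen, Matrix.cons_val]; linarith, Complex.ext ?_ ?_⟩
    · simp [dParam, dCorner, dDir, hre']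
    · simp [dParam, dCorner, dDir]

/-- **Uniqueness of the parametrisation** on the half-open sides. -/
theorem dParam_inj (hα : 0 < α) (hβ : 0 < β) {k k' : Fin 4} {s s' : ℝ} (_h0 : 0 ≤ s) (h1 : s < dLen α β k)
    (_h0' : 0 ≤ s') (h1' : s' < dLen α β k') (h : dParam α β k s = dParam α β k' s') : k = k' ∧ s = s' := by
  have hre := congrArg Complex.re h
  have him := congrArg Complex.im h
  rcases dParam_re_im α β k s with ⟨rfl, h2, h3⟩ | ⟨rfl, h2, h3⟩ | ⟨rfl, h2, h3⟩ | ⟨rfl, h2, h3⟩ <;>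
    rcases dParam_re_im α β k' s' with ⟨rfl, h2', h3'⟩ | ⟨rfl, h2', h3'⟩ | ⟨rfl, h2', h3'⟩ | ⟨rfl, h2', h3'⟩ <;>
    simp only [dLen, Matrix.cons_val] at h1 h1' <;> rw [h2, h2'] at hre <;> rw [h3, h3'] at him <;>
    first | exact ⟨rfl, by linarith⟩ | (exfalso; linarith)

/-! ## The boundary position -/

/-- The width of a position block: `2α + 2β + 1`, larger than every side. -/
def dBlock (α β : ℝ) : ℝ := 2 * α + 2 * β + 1

/-- The block offset of side `k`: `0, P, 2P, 3P` with `P = dBlock α β`. -/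
def dLo (α β : ℝ) (k : Fin 4) : ℝ := ![0, dBlock α β, 2 * dBlock α β, 3 * dBlock α β] k

/-- The BOUNDARY POSITION of a point of the rectangle's boundary: `dLo k + (arc length along side k)` on the
half-open side `k` (each side contains its first corner and not its last), counter-clockwise from the
corner `(-α, -β)` at position `0`; junk off the boundary. -/
def dPos (α β : ℝ) (w : ℂ) : ℝ :=
  if w.im = -β ∧ w.re < α then w.re + α
  else if w.re = α ∧ w.im < β then dBlock α β + (w.im + β)
  else if w.im = β ∧ -α < w.re then 2 * dBlock α β + (α - w.re)
  else 3 * dBlock α β + (β - w.im)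

/-- Every side is shorter than a position block. -/
theorem dLen_lt_dBlock (hα : 0 < α) (hβ : 0 < β) (k : Fin 4) : dLen α β k < dBlock α β := by
  fin_cases k <;> simp [dLen, dBlock] <;> linarith

/-- **The boundary position of a parametrised boundary point**: `dPos (dParam k s) = dLo k + s` for
`0 ≤ s < dLen k`. -/
theorem dPos_dParam (hα : 0 < α) (hβ : 0 < β) (k : Fin 4) {s : ℝ} (_h0 : 0 ≤ s) (h1 : s < dLen α β k) :
    dPos α β (dParam α β k s) = dLo α β k + s := by
  rcases dParam_re_im α β k s with ⟨rfl, hre, him⟩ | ⟨rfl, hre, him⟩ | ⟨rfl, hre, him⟩ | ⟨rfl, hre, him⟩ <;>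
    simp only [dLen, dLo, Matrix.cons_val] at h1 ⊢ <;> unfold dPos
  · rw [if_pos ⟨him, by rw [hre]; linarith⟩, hre]; ring
  · rw [if_neg (by rintro ⟨-, h⟩; rw [hre] at h; linarith), if_pos ⟨hre, by rw [him]; linarith⟩, him]; ring
  · rw [if_neg (by rintro ⟨h, -⟩; rw [him] at h; linarith), if_neg (by rintro ⟨-, h⟩; rw [him] at h; linarith),
      if_pos ⟨him, by rw [hre]; linarith⟩, hre]; ring
  · rw [if_neg (by rintro ⟨h, -⟩; rw [him] at h; linarith), if_neg (by rintro ⟨h, -⟩; rw [hre] at h; linarith),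
      if_neg (by rintro ⟨-, h⟩; rw [hre] at h; linarith), him]; ring

/-- Block offsets of distinct sides are a full block apart: if `dLo k' ≤ dLo k + dBlock` with `k' ≠ k` and
`k' ≠ k + 1` (or `k = 3`), then `dLo k' + dBlock ≤ dLo k`. -/
theorem dLo_add_dBlock_le (hα : 0 < α) (hβ : 0 < β) {k k' : Fin 4} (hne : k' ≠ k) (hne' : k' ≠ k + 1 ∨ k = 3)
    (h : dLo α β k' ≤ dLo α β k + dBlock α β) : dLo α β k' + dBlock α β ≤ dLo α β k := by
  have hB : 0 < dBlock α β := by unfold dBlock; linarith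
  fin_cases k <;> fin_cases k' <;> simp [dLo] at hne hne' h ⊢ <;> linarith

/-- Below the start of a block nothing from that block or later. -/
theorem dLo_add_dBlock_le_of_lt (hα : 0 < α) (hβ : 0 < β) {k k' : Fin 4} (hne : k' ≠ k)
    (h : dLo α β k' < dLo α β k + dBlock α β) : dLo α β k' + dBlock α β ≤ dLo α β k := by
  have hB : 0 < dBlock α β := by unfold dBlock; linarith
  fin_cases k <;> fin_cases k' <;> simp [dLo] at hne h ⊢ <;> linarith

/-- For `k ≠ 3` the next block starts one block later. -/
theorem dLo_succ {k : Fin 4} (hk : k ≠ 3) : dLo α β (k + 1) = dLo α β k + dBlock α β := by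
  fin_cases k <;> simp [dLo] at hk ⊢ <;> ring

/-- Block offsets are nonnegative, and vanish only for the first block. -/
theorem dLo_nonneg (hα : 0 < α) (hβ : 0 < β) (k : Fin 4) : 0 ≤ dLo α β k ∧ (dLo α β k ≤ 0 → k = 0) := by
  have hB : 0 < dBlock α β := by unfold dBlock; linarith
  fin_cases k
  · exact ⟨by simp [dLo], fun _ => rfl⟩
  · refine ⟨by simp [dLo]; linarith, fun h => ?_⟩
    simp [dLo] at h; linarith
  · refine ⟨by simp [dLo]; linarith, fun h => ?_⟩
    simp [dLo] at h; linarith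
  · refine ⟨by simp [dLo]; linarith, fun h => ?_⟩
    simp [dLo] at h; linarith

/-- The last block is the highest. -/
theorem dLo_add_dBlock_le_three (hα : 0 < α) (hβ : 0 < β) {k : Fin 4} (hk : k ≠ 3) :
    dLo α β k + dBlock α β ≤ dLo α β 3 := by
  have hB : 0 < dBlock α β := by unfold dBlock; linarith
  fin_cases k <;> simp [dLo] at hk ⊢ <;> linarith

/-! ## The mark-step lemmas -/

/-- Counting with indicators: if `a ↔ b ∨ c` and `b, c` are incompatible then `[a] = [b] + [c]`. -/
theorem ite_eq_ite_add_ite {a b c : Prop} [Decidable a] [Decidable b] [Decidable c] (h : a ↔ b ∨ c)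
    (h' : b → ¬ c) : (if a then 1 else 0 : ℕ) = (if b then 1 else 0) + (if c then 1 else 0) := by
  by_cases hb : b
  · rw [if_pos (h.2 (Or.inl hb)), if_pos hb, if_neg (h' hb)]
  · by_cases hc : c
    · rw [if_pos (h.2 (Or.inr hc)), if_neg hb, if_pos hc]
    · rw [if_neg (fun ha => (h.1 ha).elim hb hc), if_neg hb, if_neg hc]

/-- **Mark step along a boundary segment, away from the cut.** `[P, V]` a piece of side `k`
(`P = dParam k s`, `V = dParam k t`, `0 ≤ s < t ≤ dLen k`, not ending at the cut corner `(-α,-β)`), `M` a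
boundary point off the open segment `(P, V)`: then `dPos M ≤ dPos V ↔ (dPos M ≤ dPos P ∨ M = V)`, the two
alternatives being incompatible — i.e. `[dPos M ≤ dPos V] = [dPos M ≤ dPos P] + [M = V]`. -/
theorem markStep (hα : 0 < α) (hβ : 0 < β) {k : Fin 4} {s t : ℝ} (hs : 0 ≤ s) (hst : s < t)
    (ht : t ≤ dLen α β k) (hcut : ¬ (k = 3 ∧ t = dLen α β k)) {M : ℂ} {k' : Fin 4} {m : ℝ} (hm : 0 ≤ m)
    (hm' : m < dLen α β k') (hM : M = dParam α β k' m)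
    (hoff : M ∉ openSegment ℝ (dParam α β k s) (dParam α β k t)) :
    (dPos α β M ≤ dPos α β (dParam α β k t) ↔
        (dPos α β M ≤ dPos α β (dParam α β k s) ∨ M = dParam α β k t)) ∧
      (dPos α β M ≤ dPos α β (dParam α β k s) → M ≠ dParam α β k t) := by
  subst hM
  have hB : 0 < dBlock α β := by unfold dBlock; linarith
  have hlenk := dLen_lt_dBlock hα hβ k
  have hlenk' := dLen_lt_dBlock hα hβ k'
  rw [dPos_dParam hα hβ k' hm hm', dPos_dParam hα hβ k hs (lt_of_lt_of_le hst ht)]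
  rcases ht.lt_or_eq with ht | ht
  · -- `V` is not the last corner of its side
    rw [dPos_dParam hα hβ k (by linarith) ht]
    refine ⟨⟨fun h => ?_, ?_⟩, ?_⟩
    · by_cases hkk : k' = k
      · subst hkk
        rcases le_or_gt m s with hms | hms
        · exact Or.inl (by linarith)
        · rcases (show m ≤ t by linarith).lt_or_eq with hmt | rfl
          · exact absurd (dParam_mem_openSegment k' hms hmt) hoff
          · exact Or.inr rfl
      · have := dLo_add_dBlock_le_of_lt hα hβ hkk (by linarith)
        exact Or.inl (by linarith)
    · rintro (h | h)
      · linarith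
      · obtain ⟨rfl, rfl⟩ := dParam_inj hα hβ hm hm' (by linarith) ht h
        exact le_rfl
    · intro h heq
      obtain ⟨rfl, rfl⟩ := dParam_inj hα hβ hm hm' (by linarith) ht heq
      linarith
  · -- `V` is the corner `k + 1`, `k ≠ 3`
    subst ht
    have hk3 : k ≠ 3 := fun h => hcut ⟨h, rfl⟩
    rw [dParam_dLen, ← dParam_zero, dPos_dParam hα hβ (k + 1) le_rfl (dLen_pos hα hβ _), add_zero, dLo_succ hk3]
    refine ⟨⟨fun h => ?_, ?_⟩, ?_⟩
    · by_cases hkk1 : k' = k + 1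
      · subst hkk1
        rw [dLo_succ hk3] at h
        have hm0 : m = 0 := by linarith
        subst hm0
        exact Or.inr rfl
      · by_cases hkk : k' = k
        · subst hkk
          rcases le_or_gt m s with hms | hms
          · exact Or.inl (by linarith)
          · exact absurd (dParam_mem_openSegment k' hms hm') hoff
        · have := dLo_add_dBlock_le hα hβ hkk (Or.inl hkk1) (by linarith)
          exact Or.inl (by linarith)
    · rintro (h | h)
      · linarith
      · obtain ⟨rfl, rfl⟩ := dParam_inj hα hβ hm hm' le_rfl (dLen_pos hα hβ _) h
        rw [dLo_succ hk3]; linarith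
    · intro h heq
      obtain ⟨rfl, rfl⟩ := dParam_inj hα hβ hm hm' le_rfl (dLen_pos hα hβ _) heq
      rw [dLo_succ hk3] at h
      linarith

/-- **Mark step across the cut.** For the last piece `[P, V]` of side `3` ending at the cut corner
`V = (-α,-β)` (position `0`) and a boundary point `M` off `(P, V)`: `dPos M ≤ dPos P`, and
`dPos M ≤ dPos V ↔ M = V`. -/
theorem markStep_cut (hα : 0 < α) (hβ : 0 < β) {s : ℝ} (hs : 0 ≤ s) (hst : s < dLen α β 3) {M : ℂ}
    {k' : Fin 4} {m : ℝ} (hm : 0 ≤ m) (hm' : m < dLen α β k') (hM : M = dParam α β k' m)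
    (hoff : M ∉ openSegment ℝ (dParam α β 3 s) (dParam α β 3 (dLen α β 3))) :
    dPos α β M ≤ dPos α β (dParam α β 3 s) ∧
      (dPos α β M ≤ dPos α β (dParam α β 3 (dLen α β 3)) ↔ M = dParam α β 3 (dLen α β 3)) := by
  subst hM
  have hB : 0 < dBlock α β := by unfold dBlock; linarith
  have hlenk' := dLen_lt_dBlock hα hβ k'
  have h30 : (3 : Fin 4) + 1 = 0 := rfl
  rw [dPos_dParam hα hβ k' hm hm', dPos_dParam hα hβ 3 hs hst, dParam_dLen, h30, ← dParam_zero,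
    dPos_dParam hα hβ 0 le_rfl (dLen_pos hα hβ _), add_zero]
  refine ⟨?_, ⟨fun h => ?_, fun h => ?_⟩⟩
  · by_cases hk3 : k' = 3
    · subst hk3
      rcases le_or_gt m s with hms | hms
      · linarith
      · exact absurd (dParam_mem_openSegment 3 hms hm') hoff
    · have := dLo_add_dBlock_le_three hα hβ hk3
      linarith
  · have h0 := dLo_nonneg hα hβ k'
    have h00 : dLo α β 0 = 0 := by simp [dLo]
    rw [h00] at h
    obtain rfl := h0.2 (by linarith)
    have hm0 : m = 0 := by rw [h00] at h; linarith
    subst hm0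
    rfl
  · obtain ⟨rfl, rfl⟩ := dParam_inj hα hβ hm hm' (le_refl (0 : ℝ)) (dLen_pos hα hβ _) h
    simp [dLo]


/-- **Registered form of the mark step** (`--supports` the crux; helper of `stub_exactPotentialTracePh`, clause
(TURN)): along an oriented boundary segment `[P, V]` of a side of the frame rectangle not ending at the cut
corner, a boundary point `M` off `(P, V)` satisfies `[dPos M ≤ dPos V] = [dPos M ≤ dPos P] + [M = V]`. -/
theorem markStep_of_offSegment : ∀ (α β : ℝ), 0 < α → 0 < β → ∀ (k : Fin 4) (s t : ℝ), 0 ≤ s → s < t → t ≤ dLen α β k → ¬ (k = 3 ∧ t = dLen α β k) → ∀ (k' : Fin 4) (m : ℝ), 0 ≤ m → m < dLen α β k' → dParam α β k' m ∉ openSegment ℝ (dParam α β k s) (dParam α β k t) → ((dPos α β (dParam α β k' m) ≤ dPos α β (dParam α β k t) ↔ (dPos α β (dParam α β k' m) ≤ dPos α β (dParam α β k s) ∨ dParam α β k' m = dParam α β k t)) ∧ (dPos α β (dParam α β k' m) ≤ dPos α β (dParam α β k s) → dParam α β k' m ≠ dParam α β k t)) := by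
  intro α β hα hβ k s t hs hst ht hcut k' m hm hm' hoff
  exact markStep hα hβ hs hst ht hcut hm hm' rfl hoff

end Summit.CriticalPhenomena.CardyFormulaZ2.Cruxes.ParafermionToSLESixFamilies.PotentialDarbouxPicardDiamond

end
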